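import Summits.QuantumFields.QCD.Theorems.PauliWegnerSeaFMClosureUnquenchedRepairedC2BetaFloor
import Summits.QuantumFields.QCD.Theorems.PauliWegnerSeaFMClosureUnquenchedClosureC1Aux2

/-!
# Crux `FMClosureUnquenched` (K2, stmt-QuantumFields-11512), line `von-mises-circles` — the SPLIT of clause (ii)
# into its outward and inward halves (continuation lead c3)

Registered sub-goals `clauseII_of_split` and `outwardGuard_eventually_false` of the crux's skeleton
(`Cruxes/FMClosureUnquenched/Lines/von_mises_circles_c2.lean`, lead c3 registry).

* `conclusion_of_outward_of_inward` — an OUTWARD decay bound (clause (ii) for `K (1 + |log a_k|) ≤ a_k ‖v‖`, the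
  conclusion of the landed `closure_from_betaFloor` / `coreOutward_of_twoStarBounds_farStability`) and an INWARD
  decay bound inside the same log window, each at its own exponent, merge into the crux's `Conclusion` VERBATIM
  (Lyapunov lowering of the exponent, `c1_cruxMoment_rpow_le`).
* `clauseII_of_split` — for `N_f ≤ 16` and a regularisation whose massless scheme scales asymptotically (what
  `ChiralOneScaleTrajectory` supplies), the averaged two-star package `∀ N_f, TwoStarBounds N_f`, far stability
  `∀ N_f, FarStability N_f` and the INWARD core (decay inside every log window, k-uniform constant) turn the one-scale
  `Input` AS TYPED into the `Conclusion` AS TYPED: exactly the shape in which `PauliWegnerSea.closes` consumes K2.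
* `outwardGuard_eventually_false` — the excluded window of an outward-only clause has DIVERGENT physical radius
  `K (1 + |log a_k|)`; on every ball of fixed physical radius the outward guard is eventually void.  (So the inward
  half is not droppable: an outward-only clause (ii) bounds no continuum two-point function at a fixed separation.)

References: Aizenman–Schenker–Friedrich–Hundertmark, CMP 224 (2001) 219, Thm 2 [AizenmanEtAl2001] (the outward
bootstrap); the merge and the divergence are elementary.
-/

noncomputable section

namespace Summit.QuantumFields.QCD.Theorems.VonMisesCirclesC3

open scoped BigOperators Topology
open MeasureTheory Filter
open Literature.MathematicalPhysics.QuantumFieldTheory Literature.MathematicalPhysics.QuantumLattice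
  Literature.Probability.LatticeModels
open Summit.QuantumFields.QCD.Theorems.VonMisesCircles Summit.QuantumFields.QCD.Theorems.VonMisesCirclesC1
  Summit.QuantumFields.QCD.Theorems.VonMisesCirclesC2

/-! ## 1. Merging an outward and an inward decay bound into the crux's `Conclusion` -/

/-- One-region step: a decay bound for `cruxMoment` at exponent `sᵢ ≤ 1` passes to every smaller exponent `s`, with
constant `max Cᵢ 1` and rate `δᵢ s / sᵢ` (Lyapunov lowering under the phase-quenched probability measure). [folklore] -/
theorem lower_decay {Nf : ℕ} {s sᵢ δᵢ Cᵢ : ℝ} (hs0 : 0 < s) (hsi1 : sᵢ ≤ 1) (hle : s ≤ sᵢ)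
    (β : ℝ) (mq : Fin Nf → ℝ) (S : ℕ) (f : Fin Nf) (v : Literature.Probability.LatticeModels.Site 4)
    (t : ℝ) (h : cruxMoment Nf β mq S f v sᵢ ≤ Cᵢ * Real.exp (-(δᵢ * t))) :
    cruxMoment Nf β mq S f v s ≤ max Cᵢ 1 * Real.exp (-(δᵢ * (s / sᵢ) * t)) := by
  have hsi : 0 < sᵢ := lt_of_lt_of_le hs0 hle
  have hr0 : 0 < s / sᵢ := div_pos hs0 hsi
  have hr1 : s / sᵢ ≤ 1 := (div_le_one hsi).mpr hle
  have hC1 : (1 : ℝ) ≤ max Cᵢ 1 := le_max_right _ _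
  have hC0 : 0 ≤ max Cᵢ 1 := zero_le_one.trans hC1
  have h' : cruxMoment Nf β mq S f v sᵢ ≤ max Cᵢ 1 * Real.exp (-(δᵢ * t)) :=
    h.trans (mul_le_mul_of_nonneg_right (le_max_left _ _) (Real.exp_pos _).le)
  calc cruxMoment Nf β mq S f v s
      ≤ (cruxMoment Nf β mq S f v sᵢ) ^ (s / sᵢ) := c1_cruxMoment_rpow_le β mq S f v hs0 hle hsi1
    _ ≤ (max Cᵢ 1 * Real.exp (-(δᵢ * t))) ^ (s / sᵢ) :=
        Real.rpow_le_rpow (c1_cruxMoment_nonneg β mq S f v sᵢ) h' hr0.le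
    _ = (max Cᵢ 1) ^ (s / sᵢ) * Real.exp (-(δᵢ * (s / sᵢ) * t)) := by
        rw [Real.mul_rpow hC0 (Real.exp_pos _).le, ← Real.exp_mul]
        congr 2
        ring
    _ ≤ max Cᵢ 1 * Real.exp (-(δᵢ * (s / sᵢ) * t)) := by
        apply mul_le_mul_of_nonneg_right _ (Real.exp_pos _).le
        calc (max Cᵢ 1) ^ (s / sᵢ) ≤ (max Cᵢ 1) ^ (1 : ℝ) := Real.rpow_le_rpow_of_exponent_le hC1 hr1
          _ = max Cᵢ 1 := Real.rpow_one _

/-- **Outward ∧ inward ⇒ clause (ii) verbatim** for one `(N_f, reg, m)`: an outward decay bound beyond the log window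
`K (1 + |log a_k|) ≤ a_k ‖v‖` (any `K`, exponent `s₁`) and an inward decay bound inside EVERY log window (its own
exponent per window) give the crux's `Conclusion` (`s = min s₁ s₂`, `δ = min`, `C = max`). [folklore] -/
theorem conclusion_of_outward_of_inward {Nf : ℕ} (reg : QCDRegularisation Nf) (m : Fin Nf → ℝ)
    (hout : ∃ s δ C K : ℝ, 0 < s ∧ s < 1 ∧ 0 < δ ∧ ∀ᶠ k in atTop, ∀ S : ℕ, reg.L k ≤ S →
      ∀ (f : Fin Nf) (v : Literature.Probability.LatticeModels.Site 4), v ∈ box 4 S →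
        K * (1 + |Real.log (reg.a k)|) ≤ reg.a k * ‖v‖ →
          cruxMoment Nf (reg.β k) (bareMass reg m k) S f v s ≤ C * Real.exp (-(δ * (reg.a k * ‖v‖))))
    (hin : ∀ K : ℝ, ∃ s δ C : ℝ, 0 < s ∧ s < 1 ∧ 0 < δ ∧ ∀ᶠ k in atTop, ∀ S : ℕ, reg.L k ≤ S →
      ∀ (f : Fin Nf) (v : Literature.Probability.LatticeModels.Site 4), v ∈ box 4 S →
        reg.a k * ‖v‖ ≤ K * (1 + |Real.log (reg.a k)|) →
          cruxMoment Nf (reg.β k) (bareMass reg m k) S f v s ≤ C * Real.exp (-(δ * (reg.a k * ‖v‖)))) :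
    Conclusion Nf reg m := by
  obtain ⟨s₁, δ₁, C₁, K, hs₁, hs₁1, hδ₁, hev₁⟩ := hout
  obtain ⟨s₂, δ₂, C₂, hs₂, hs₂1, hδ₂, hev₂⟩ := hin K
  have hs0 : 0 < min s₁ s₂ := lt_min hs₁ hs₂
  refine ⟨min s₁ s₂, min (δ₁ * (min s₁ s₂ / s₁)) (δ₂ * (min s₁ s₂ / s₂)), max (max C₁ 1) (max C₂ 1), hs0,
    lt_of_le_of_lt (min_le_left _ _) hs₁1,
    lt_min (mul_pos hδ₁ (div_pos hs0 hs₁)) (mul_pos hδ₂ (div_pos hs0 hs₂)), ?_⟩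
  filter_upwards [hev₁, hev₂] with k hk₁ hk₂ S hS f v hv
  have ht : 0 ≤ reg.a k * ‖v‖ := mul_nonneg (reg.a_pos k).le (norm_nonneg v)
  have hM : 0 ≤ max (max C₁ 1) (max C₂ 1) :=
    le_trans (zero_le_one.trans (le_max_right _ _)) (le_max_left _ _)
  rcases le_total (K * (1 + |Real.log (reg.a k)|)) (reg.a k * ‖v‖) with hfar | hnear
  · calc cruxMoment Nf (reg.β k) (bareMass reg m k) S f v (min s₁ s₂)
        ≤ max C₁ 1 * Real.exp (-(δ₁ * (min s₁ s₂ / s₁) * (reg.a k * ‖v‖))) :=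
          lower_decay hs0 hs₁1.le (min_le_left _ _) _ _ S f v _ (hk₁ S hS f v hv hfar)
      _ ≤ max (max C₁ 1) (max C₂ 1) *
            Real.exp (-(min (δ₁ * (min s₁ s₂ / s₁)) (δ₂ * (min s₁ s₂ / s₂)) * (reg.a k * ‖v‖))) := by
          apply mul_le_mul (le_max_left _ _) _ (Real.exp_pos _).le hM
          exact Real.exp_le_exp.mpr (neg_le_neg (mul_le_mul_of_nonneg_right (min_le_left _ _) ht))
  · calc cruxMoment Nf (reg.β k) (bareMass reg m k) S f v (min s₁ s₂)
        ≤ max C₂ 1 * Real.exp (-(δ₂ * (min s₁ s₂ / s₂) * (reg.a k * ‖v‖))) :=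
          lower_decay hs0 hs₂1.le (min_le_right _ _) _ _ S f v _ (hk₂ S hS f v hv hnear)
      _ ≤ max (max C₁ 1) (max C₂ 1) *
            Real.exp (-(min (δ₁ * (min s₁ s₂ / s₁)) (δ₂ * (min s₁ s₂ / s₂)) * (reg.a k * ‖v‖))) := by
          apply mul_le_mul (le_max_right _ _) _ (Real.exp_pos _).le hM
          exact Real.exp_le_exp.mpr (neg_le_neg (mul_le_mul_of_nonneg_right (min_le_right _ _) ht))

/-! ## 2. Clause (ii) as typed from the split, in the shape `closes` consumes it -/

/-- **Clause (ii) AS TYPED from the averaged two-star package, far stability and the inward core, on asymptotically free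
trajectories** (registered sub-goal `clauseII_of_split`): for `N_f ≤ 16` and a regularisation whose massless scheme scales
asymptotically, `(∀ N_f, TwoStarBounds N_f) → (∀ N_f, FarStability N_f) → (inward core) → ∀ m > 0, Input → Conclusion`.
The outward half is the landed `closure_from_betaFloor` (its coupling floor discharged by
`betaFloor_of_hasAsymptoticScaling`); the inward core is the NEW crux (decay inside every log window
`a_k ‖v‖ ≤ K (1 + |log a_k|)` with a k-uniform constant, for every `N_f`, regularisation and mass tuple satisfying the
one-scale input). [cite: AizenmanEtAl2001, Thm 2] -/
theorem clauseII_of_split :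
    (∀ Nf : ℕ, TwoStarBounds Nf) → (∀ Nf : ℕ, FarStability Nf) →
    (∀ (Nf : ℕ) (reg : QCDRegularisation Nf) (m : Fin Nf → ℝ), (∀ f, 0 < m f) → Input Nf reg m →
      ∀ K : ℝ, ∃ s δ C : ℝ, 0 < s ∧ s < 1 ∧ 0 < δ ∧ ∀ᶠ k in atTop, ∀ S : ℕ, reg.L k ≤ S →
        ∀ (f : Fin Nf) (v : Literature.Probability.LatticeModels.Site 4), v ∈ box 4 S →
          reg.a k * ‖v‖ ≤ K * (1 + |Real.log (reg.a k)|) →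
            cruxMoment Nf (reg.β k) (bareMass reg m k) S f v s ≤ C * Real.exp (-(δ * (reg.a k * ‖v‖)))) →
    ∀ (Nf : ℕ), Nf ≤ 16 → ∀ (reg : QCDRegularisation Nf), (reg.scheme 0 0 0).HasAsymptoticScaling →
      ∀ (m : Fin Nf → ℝ), (∀ f, 0 < m f) → Input Nf reg m → Conclusion Nf reg m := by
  intro hT hF hin Nf hNf reg hAS m hm hInput
  obtain ⟨s, δ, C, K₀, ℓ₀, hs0, hs1, hδ, _hC, hwin, -, hdec⟩ :=
    closure_from_betaFloor Nf reg m (hT Nf) (hF Nf) collarResolventBounds_holds (hoppingDecay_holds Nf)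
      (betaFloor_of_hasAsymptoticScaling hNf reg 0 0 0 hAS) hInput
  refine conclusion_of_outward_of_inward reg m ⟨s, δ, C, K₀, hs0, hs1, hδ, ?_⟩ (hin Nf reg m hm hInput)
  filter_upwards [hwin, hdec] with k hkwin hk S hS f v hv hfar
  have hℓ : (ℓ₀ k f : ℝ) ≤ ‖v‖ := by
    have ha : 0 < reg.a k := reg.a_pos k
    have h1 : (ℓ₀ k f : ℝ) * reg.a k ≤ reg.a k * ‖v‖ := (hkwin f).trans hfar
    nlinarith
  exact hk S hS f v hv hℓ

/-! ## 3. The inward half cannot be dropped: the outward guard is void at every fixed physical distance -/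

/-- The physical radius `K (1 + |log a_k|)` of the window excluded by an outward-only clause DIVERGES along every
regularisation (`a_k → 0⁺`). [folklore] -/
theorem tendsto_logWindow_atTop {Nf : ℕ} (reg : QCDRegularisation Nf) {K : ℝ} (hK : 0 < K) :
    Tendsto (fun k => K * (1 + |Real.log (reg.a k)|)) atTop atTop := by
  have h1 : Tendsto reg.a atTop (𝓝[>] 0) :=
    tendsto_nhdsWithin_iff.mpr ⟨reg.tendsto_a, Eventually.of_forall fun k => reg.a_pos k⟩
  have h2 : Tendsto (fun k => Real.log (reg.a k)) atTop atBot := Real.tendsto_log_nhdsGT_zero.comp h1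
  have h3 : Tendsto (fun k => |Real.log (reg.a k)|) atTop atTop := tendsto_abs_atBot_atTop.comp h2
  exact (tendsto_atTop_add_const_left _ 1 h3).const_mul_atTop hK

/-- **On every ball of fixed physical radius `r` the outward guard is eventually false** (registered sub-goal
`outwardGuard_eventually_false`): for all large `k`, no `v` with `a_k ‖v‖ ≤ r` satisfies `K (1 + |log a_k|) ≤ a_k ‖v‖`.
So an outward-only clause (ii) says nothing about the continuum two-point function at any fixed separation — the
inward half of the split is where fixed-distance physics lives. [folklore] -/
theorem outwardGuard_eventually_false :
    ∀ (Nf : ℕ) (reg : QCDRegularisation Nf) (K : ℝ), 0 < K → ∀ r : ℝ,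
      ∀ᶠ k in atTop, ∀ v : Literature.Probability.LatticeModels.Site 4,
        reg.a k * ‖v‖ ≤ r → ¬ (K * (1 + |Real.log (reg.a k)|) ≤ reg.a k * ‖v‖) := by
  intro Nf reg K hK r
  filter_upwards [(tendsto_logWindow_atTop reg hK).eventually_gt_atTop r] with k hk v hv h
  exact absurd (h.trans hv) (not_le.mpr hk)

end Summit.QuantumFields.QCD.Theorems.VonMisesCirclesC3

end
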